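import Literature.NumberTheory.DiophantineGeometry.AbcWave0
import HarnessLib

/-!
# Proof of `Literature.NumberTheory.DiophantineGeometry.infinite_setOf_one_lt_quality` (abc.S05, unconditional part)

`Literature/NumberTheory/DiophantineGeometry/AbcQualityProofs.lean` discharges the named fact
`Literature.NumberTheory.DiophantineGeometry.infinite_setOf_one_lt_quality` of `AbcWave0` ("there are infinitely many abc triples of
quality `> 1`", "e.g. the triples `1 + (9^k − 1) = 9^k`" [cite: Masser2002]) with exactly that
family: `8 ∣ 9^k − 1`, so `rad(1 · (9^k − 1) · 9^k) ≤ 3 · (9^k − 1)/4 < 9^k = c`, i.e. quality `> 1`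
(Granville–Tucker's / Bombieri–Gubler's Example 12.4.13 is the sub-family `3^{2^n}`).
No statement is changed; this file only adds the proof.
-/

noncomputable section

open UniqueFactorizationMonoid

namespace Literature.NumberTheory.DiophantineGeometry

/-- In `ℕ` the radical of a prime is the prime itself. [folklore] -/
theorem radical_eq_self_of_prime {p : ℕ} (hp : p.Prime) : radical p = p := by
  rw [radical_of_prime (Nat.prime_iff.mp hp)]; simp

/-- `rad(1 · (9^k − 1) · 9^k) · 4 ≤ 3 · (9^k − 1)` for `k ≥ 1`: the radical of `9^k` is `3` and `8 ∣ 9^k − 1`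
costs the radical of `9^k − 1` a factor `4`. [folklore] -/
theorem rad_nine_pow_le (k : ℕ) (hk : 0 < k) : rad 1 (9 ^ k - 1) (9 ^ k) * 4 ≤ 3 * (9 ^ k - 1) := by
  obtain ⟨m, hm⟩ : 8 ∣ 9 ^ k - 1 := by
    simpa using Nat.sub_dvd_pow_sub_pow 9 1 k
  have hm0 : 0 < m := by
    rcases Nat.eq_zero_or_pos m with rfl | h
    · have : 9 ^ 1 ≤ 9 ^ k := Nat.pow_le_pow_right (by norm_num) hk
      omega
    · exact h
  have h9 : radical (9 ^ k : ℕ) = 3 := by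
    rw [radical_pow _ hk.ne', show (9 : ℕ) = 3 ^ 2 by norm_num, radical_pow _ (by norm_num),
      radical_eq_self_of_prime (by norm_num)]
  have h8 : radical (8 : ℕ) = 2 := by
    rw [show (8 : ℕ) = 2 ^ 3 by norm_num, radical_pow _ (by norm_num),
      radical_eq_self_of_prime (by norm_num)]
  have h1 : radical (9 ^ k - 1 : ℕ) ∣ 2 * m := by
    rw [hm]
    calc radical (8 * m) ∣ radical 8 * radical m := radical_mul_dvd
      _ = 2 * radical m := by rw [h8]
      _ ∣ 2 * m := mul_dvd_mul_left 2 radical_dvd_self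
  have h2 : rad 1 (9 ^ k - 1) (9 ^ k) ∣ 2 * m * 3 := by
    rw [rad_def, one_mul]
    calc radical ((9 ^ k - 1) * 9 ^ k) ∣ radical (9 ^ k - 1) * radical (9 ^ k) := radical_mul_dvd
      _ = radical (9 ^ k - 1) * 3 := by rw [h9]
      _ ∣ 2 * m * 3 := mul_dvd_mul_right h1 3
  have h3 := Nat.le_of_dvd (by positivity) h2
  omega

/-- For `k ≥ 1`, `(1, 9^k − 1, 9^k)` is an abc triple of quality `> 1`. [cite: Masser2002] -/
theorem nine_pow_quality (k : ℕ) (hk : 1 ≤ k) :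
    IsABCTriple 1 (9 ^ k - 1) (9 ^ k) ∧ 1 < quality 1 (9 ^ k - 1) (9 ^ k) := by
  have h9 : 9 ≤ 9 ^ k := by
    calc 9 = 9 ^ 1 := by norm_num
      _ ≤ 9 ^ k := Nat.pow_le_pow_right (by norm_num) hk
  refine ⟨⟨by norm_num, by omega, by omega, Nat.coprime_one_left _⟩, ?_⟩
  have hle := rad_nine_pow_le k (by omega)
  have hlt : rad 1 (9 ^ k - 1) (9 ^ k) < 9 ^ k := by omega
  have hgt : 1 < rad 1 (9 ^ k - 1) (9 ^ k) := by
    rw [rad_def, Nat.one_lt_radical_iff]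
    have : 1 < 9 ^ k - 1 := by omega
    calc 1 < 9 ^ k - 1 := this
      _ = 1 * (9 ^ k - 1) * 1 := by ring
      _ ≤ 1 * (9 ^ k - 1) * 9 ^ k := Nat.mul_le_mul_left _ (by omega)
  rw [quality, one_lt_div (Real.log_pos (by exact_mod_cast hgt))]
  apply Real.log_lt_log (by positivity)
  exact_mod_cast hlt

/-- **Discharge of `Literature.NumberTheory.DiophantineGeometry.infinite_setOf_one_lt_quality`** (abc.S05, unconditional part): there
are infinitely many abc triples of quality `> 1`, namely `1 + (9^k − 1) = 9^k`, `k ≥ 1`.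
[cite: Masser2002] -/
theorem infinite_setOf_one_lt_quality_holds : infinite_setOf_one_lt_quality := by
  have hinj : Function.Injective fun k : ℕ => ((1 : ℕ), 9 ^ (k + 1) - 1, 9 ^ (k + 1)) := by
    intro k k' h
    have h3 : 9 ^ (k + 1) = 9 ^ (k' + 1) := congrArg (fun t : ℕ × ℕ × ℕ => t.2.2) h
    have := Nat.pow_right_injective (by norm_num : 2 ≤ 9) h3
    omega
  exact Set.infinite_of_injective_forall_mem hinj fun k => nine_pow_quality (k + 1) (by omega)

end Literature.NumberTheory.DiophantineGeometry

end
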